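import Mathlib
import Literature.MathematicalPhysics.QuantumLattice.YangMillsClassical
import HarnessLib

/-!
# Volume doubling of Haar measure in the chordal (Frobenius) metric of a compact matrix group

For a compact group `G` with a continuous unitary matrix representation `ρ : G →* M_N(ℂ)`, the
pull-back `d(a, b) = ‖ρ a - ρ b‖_F` of the Frobenius distance is a left-invariant pseudo-metric,
and any left-invariant measure `μ` on `G` is **doubling** for it, with a constant depending only on
`N`:

  `μ {g | ‖ρ g - 1‖_F ≤ 2r} ≤ 5^{dim_ℝ M_N(ℂ)} · μ {g | ‖ρ g - 1‖_F ≤ r}`   for every `r > 0`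
  (`measure_chordalBall_two_mul_le`),

and all balls of the same radius have the same measure (`measure_chordalBall_eq`).  No Lie theory
is used: the proof is the volumetric covering argument, run through Fubini against Lebesgue
measure `λ` on the ambient real vector space `E = M_N(ℂ)` (`measure_ball_two_mul_le_of_forall_le`,
stated for any measurable map `φ : Ω → E` into a finite-dimensional real normed space all of whose
`r`-balls `{‖φ · - φ ω₁‖ ≤ r}` have measure `≤ m`): integrating the indicator of
`T = {(ω, x) | ‖φ ω - x₀‖ ≤ 2r, ‖x - φ ω‖ ≤ r/2}` first in `x` gives `λ(B_{r/2}) · μ{‖φ - x₀‖ ≤ 2r}`,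
first in `ω` gives at most `m · λ(B_{5r/2}) = m · 5^{dim E} λ(B_{r/2})`, because a non-empty fibre
`T^x` lies in one `r`-ball `{‖φ · - φ ω₁‖ ≤ r}` and forces `‖x - x₀‖ ≤ 5r/2`.

This is the small-ball / doubling input of Laplace-type concentration estimates for Gibbs-tilted
Haar measures on compact matrix groups (e.g. the discharge of
`Literature.MathematicalPhysics.QuantumFieldTheory.OneLinkLaplaceConcentration`), where it replaces
the comparison of Haar measure with Lebesgue measure in an exponential chart.  Everything here is
proved; no definition is introduced.  Folklore (volume doubling of bi-invariant metrics on compact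
Lie groups; the covering-number proof is standard, cf. the proof that Ahlfors-regular measures are
doubling).

## References

* J. Heinonen, *Lectures on Analysis on Metric Spaces*, Universitext (2001), Ch. 1 (doubling
  measures and covering arguments).
-/

noncomputable section

open MeasureTheory MeasureTheory.Measure Set Filter Metric
open scoped Topology ENNReal NNReal

namespace Literature.MeasureTheory.Group

/-! ## The abstract volumetric doubling argument -/

section Abstract

variable {Ω : Type*} [MeasurableSpace Ω] (μ : Measure Ω) [SFinite μ]
  {E : Type*} [NormedAddCommGroup E] [NormedSpace ℝ E] [FiniteDimensional ℝ E]
  [MeasurableSpace E] [BorelSpace E]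

/-- **Volumetric doubling.** Let `φ : Ω → E` be a measurable map into a finite-dimensional real
normed space and suppose every "ball" `{ω | ‖φ ω - φ ω₁‖ ≤ r}` centred on the image has
`μ`-measure at most `m`.  Then `μ {ω | ‖φ ω - x₀‖ ≤ 2r} ≤ 5^{dim E} · m` for every `x₀`.
(Fubini for the indicator of `{(ω, x) | ‖φ ω - x₀‖ ≤ 2r, ‖x - φ ω‖ ≤ r/2}` against `μ ⊗ λ`,
`λ` Lebesgue measure on `E`, and the scaling `λ(B_{5r/2}) = 5^{dim E} λ(B_{r/2})`.) [folklore] -/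
theorem measure_ball_two_mul_le_of_forall_le {φ : Ω → E} (hφ : Measurable φ) (x₀ : E) {r : ℝ}
    (hr : 0 < r) {m : ℝ≥0∞} (hm : ∀ ω₁, μ {ω | ‖φ ω - φ ω₁‖ ≤ r} ≤ m) :
    μ {ω | ‖φ ω - x₀‖ ≤ 2 * r} ≤ 5 ^ Module.finrank ℝ E * m := by
  -- Lebesgue measure on `E`
  set lam : Measure E := (Module.finBasis ℝ E).addHaar with hlam
  set D : ℕ := Module.finrank ℝ E with hD
  have hscale : lam (closedBall (0 : E) (5 * (r / 2))) = 5 ^ D * lam (closedBall (0 : E) (r / 2)) := by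
    rw [addHaar_closedBall_mul lam (0 : E) (by norm_num : (0 : ℝ) ≤ 5) (by positivity : 0 ≤ r / 2),
      ENNReal.ofReal_pow (by norm_num : (0 : ℝ) ≤ 5), hD]
    norm_num
  have hBpos : lam (closedBall (0 : E) (r / 2)) ≠ 0 :=
    (measure_closedBall_pos lam _ (by positivity)).ne'
  have hBfin : lam (closedBall (0 : E) (r / 2)) ≠ ∞ :=
    (isCompact_closedBall _ _).measure_lt_top.ne
  -- the set `B₂` and the measurable set `T ⊆ Ω × E`
  set B₂ : Set Ω := {ω | ‖φ ω - x₀‖ ≤ 2 * r} with hB₂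
  have hB₂m : MeasurableSet B₂ :=
    measurableSet_le (hφ.sub measurable_const).norm measurable_const
  set T : Set (Ω × E) := {p | ‖φ p.1 - x₀‖ ≤ 2 * r ∧ ‖p.2 - φ p.1‖ ≤ r / 2} with hT
  have hTm : MeasurableSet T := by
    refine MeasurableSet.inter ?_ ?_
    · exact measurableSet_le ((hφ.comp measurable_fst).sub measurable_const).norm measurable_const
    · exact measurableSet_le (measurable_snd.sub (hφ.comp measurable_fst)).norm measurable_const
  -- integrate first in `x`
  have h1 : (μ.prod lam) T = lam (closedBall (0 : E) (r / 2)) * μ B₂ := by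
    rw [Measure.prod_apply hTm]
    have hfib : ∀ ω, lam (Prod.mk ω ⁻¹' T) =
        B₂.indicator (fun _ => lam (closedBall (0 : E) (r / 2))) ω := by
      intro ω
      by_cases hω : ω ∈ B₂
      · rw [indicator_of_mem hω]
        have hset : Prod.mk ω ⁻¹' T = closedBall (φ ω) (r / 2) := by
          ext x
          simp only [hT, mem_preimage, mem_setOf_eq, mem_closedBall, dist_eq_norm]
          exact ⟨fun h => h.2, fun h => ⟨hω, h⟩⟩
        rw [hset, addHaar_closedBall_center]
      · rw [indicator_of_notMem hω]
        have hset : Prod.mk ω ⁻¹' T = ∅ := by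
          ext x
          simp only [hT, mem_preimage, mem_setOf_eq, mem_empty_iff_false, iff_false, not_and]
          exact fun h _ => hω h
        rw [hset, measure_empty]
    simp_rw [hfib]
    rw [lintegral_indicator_const hB₂m]
  -- integrate first in `ω`
  have h2 : (μ.prod lam) T ≤ m * lam (closedBall (0 : E) (5 * (r / 2))) := by
    rw [Measure.prod_apply_symm hTm]
    calc ∫⁻ x, μ ((fun ω => (ω, x)) ⁻¹' T) ∂lam
        ≤ ∫⁻ x, (closedBall x₀ (5 * (r / 2))).indicator (fun _ => m) x ∂lam := by
          refine lintegral_mono fun x => ?_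
          by_cases hne : ((fun ω => (ω, x)) ⁻¹' T).Nonempty
          · obtain ⟨ω₁, hω₁⟩ := hne
            simp only [hT, mem_preimage, mem_setOf_eq] at hω₁
            have hx : x ∈ closedBall x₀ (5 * (r / 2)) := by
              rw [mem_closedBall, dist_eq_norm]
              calc ‖x - x₀‖ ≤ ‖x - φ ω₁‖ + ‖φ ω₁ - x₀‖ := norm_sub_le_norm_sub_add_norm_sub _ _ _
                _ ≤ r / 2 + 2 * r := add_le_add hω₁.2 hω₁.1
                _ = 5 * (r / 2) := by ring
            rw [indicator_of_mem hx]
            refine (measure_mono ?_).trans (hm ω₁)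
            intro ω hω
            simp only [hT, mem_preimage, mem_setOf_eq] at hω
            show ‖φ ω - φ ω₁‖ ≤ r
            calc ‖φ ω - φ ω₁‖ ≤ ‖φ ω - x‖ + ‖x - φ ω₁‖ := norm_sub_le_norm_sub_add_norm_sub _ _ _
              _ ≤ r / 2 + r / 2 := by rw [norm_sub_rev]; exact add_le_add hω.2 hω₁.2
              _ = r := by ring
          · rw [not_nonempty_iff_eq_empty.mp hne, measure_empty]
            exact bot_le
      _ = m * lam (closedBall x₀ (5 * (r / 2))) := lintegral_indicator_const measurableSet_closedBall m
      _ = m * lam (closedBall (0 : E) (5 * (r / 2))) := by rw [addHaar_closedBall_center]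
  -- combine and cancel `λ(B_{r/2})`
  have h3 : μ B₂ * lam (closedBall (0 : E) (r / 2)) ≤
      (5 ^ D * m) * lam (closedBall (0 : E) (r / 2)) := by
    calc μ B₂ * lam (closedBall (0 : E) (r / 2)) = (μ.prod lam) T := by rw [h1, mul_comm]
      _ ≤ m * lam (closedBall (0 : E) (5 * (r / 2))) := h2
      _ = (5 ^ D * m) * lam (closedBall (0 : E) (r / 2)) := by rw [hscale]; ring
  exact (ENNReal.mul_le_mul_iff_left hBpos hBfin).mp h3

end Abstract

/-! ## Compact matrix groups: the chordal metric -/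

section MatrixGroup

open scoped Matrix.Norms.Frobenius

variable {G : Type*} [Group G] [TopologicalSpace G] [IsTopologicalGroup G] [MeasurableSpace G]
  [BorelSpace G] (μ : Measure G) [SFinite μ] [μ.IsMulLeftInvariant] {N : ℕ}

omit [TopologicalSpace G] [IsTopologicalGroup G] [MeasurableSpace G] [BorelSpace G] in
/-- For a unitary representation, `‖ρ(g₁⁻¹ g) - 1‖_F = ‖ρ g - ρ g₁‖_F` (left unitary invariance
of the Frobenius norm). [folklore] -/
theorem norm_map_inv_mul_sub_one (ρ : G →* Matrix (Fin N) (Fin N) ℂ)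
    (hρu : ∀ g, ρ g ∈ Matrix.unitaryGroup (Fin N) ℂ) (g₁ g : G) :
    ‖ρ (g₁⁻¹ * g) - 1‖ = ‖ρ g - ρ g₁‖ := by
  have h1 : ρ (g₁⁻¹ * g) - 1 = ρ g₁⁻¹ * (ρ g - ρ g₁) := by
    rw [mul_sub, ← map_mul, ← map_mul, inv_mul_cancel, map_one]
  rw [h1]
  exact Matrix.frobenius_norm_unitaryGroup_mul ⟨ρ g₁⁻¹, hρu _⟩ _

omit [SFinite μ] in
/-- **All chordal balls of the same radius have the same measure**: for a left-invariant `μ` and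
a unitary representation `ρ`, `μ {g | ‖ρ g - ρ g₁‖_F ≤ r} = μ {g | ‖ρ g - 1‖_F ≤ r}`. [folklore] -/
theorem measure_chordalBall_eq (ρ : G →* Matrix (Fin N) (Fin N) ℂ)
    (hρu : ∀ g, ρ g ∈ Matrix.unitaryGroup (Fin N) ℂ) (g₁ : G) (r : ℝ) :
    μ {g | ‖ρ g - ρ g₁‖ ≤ r} = μ {g | ‖ρ g - 1‖ ≤ r} := by
  have hset : {g | ‖ρ g - ρ g₁‖ ≤ r} = (fun g => g₁⁻¹ * g) ⁻¹' {g | ‖ρ g - 1‖ ≤ r} := by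
    ext g
    simp only [mem_setOf_eq, mem_preimage, norm_map_inv_mul_sub_one ρ hρu]
  rw [hset, measure_preimage_mul]

/-- **Volume doubling of Haar measure in the chordal metric.** For a left-invariant `σ`-finite
measure `μ` on a topological group `G` and a continuous unitary matrix representation
`ρ : G →* M_N(ℂ)`, `μ {g | ‖ρ g - 1‖_F ≤ 2r} ≤ 5^{dim_ℝ M_N(ℂ)} · μ {g | ‖ρ g - 1‖_F ≤ r}` for
every `r > 0`. [folklore] -/
theorem measure_chordalBall_two_mul_le (ρ : G →* Matrix (Fin N) (Fin N) ℂ) (hρc : Continuous ρ)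
    (hρu : ∀ g, ρ g ∈ Matrix.unitaryGroup (Fin N) ℂ) {r : ℝ} (hr : 0 < r) :
    μ {g | ‖ρ g - 1‖ ≤ 2 * r} ≤
      5 ^ Module.finrank ℝ (Matrix (Fin N) (Fin N) ℂ) * μ {g | ‖ρ g - 1‖ ≤ r} := by
  -- Borel structure of `M_N(ℂ)` for the (Frobenius-)norm topology, which is the one the abstract
  -- lemma sees; it is definitionally the product topology, for which `ρ` is continuous.
  letI : MeasurableSpace (Matrix (Fin N) (Fin N) ℂ) :=
    @borel _ (PseudoMetricSpace.toUniformSpace (α := Matrix (Fin N) (Fin N) ℂ)).toTopologicalSpace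
  haveI : @BorelSpace (Matrix (Fin N) (Fin N) ℂ)
      (PseudoMetricSpace.toUniformSpace (α := Matrix (Fin N) (Fin N) ℂ)).toTopologicalSpace _ := ⟨rfl⟩
  have hc : @Continuous G (Matrix (Fin N) (Fin N) ℂ) _
      (PseudoMetricSpace.toUniformSpace (α := Matrix (Fin N) (Fin N) ℂ)).toTopologicalSpace ρ := hρc
  have hφ : Measurable ρ := hc.measurable
  have h := measure_ball_two_mul_le_of_forall_le μ hφ (1 : Matrix (Fin N) (Fin N) ℂ) hr
    (m := μ {g | ‖ρ g - 1‖ ≤ r}) (fun g₁ => (measure_chordalBall_eq μ ρ hρu g₁ r).le)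
  exact h

/-- Iterated doubling: `μ {‖ρ g - 1‖_F ≤ 2^k r} ≤ (5^{dim})^k · μ {‖ρ g - 1‖_F ≤ r}`. [folklore] -/
theorem measure_chordalBall_two_pow_mul_le (ρ : G →* Matrix (Fin N) (Fin N) ℂ) (hρc : Continuous ρ)
    (hρu : ∀ g, ρ g ∈ Matrix.unitaryGroup (Fin N) ℂ) {r : ℝ} (hr : 0 < r) (k : ℕ) :
    μ {g | ‖ρ g - 1‖ ≤ 2 ^ k * r} ≤
      (5 ^ Module.finrank ℝ (Matrix (Fin N) (Fin N) ℂ)) ^ k * μ {g | ‖ρ g - 1‖ ≤ r} := by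
  induction k with
  | zero => simp
  | succ k ih =>
    have h := measure_chordalBall_two_mul_le μ ρ hρc hρu (r := 2 ^ k * r) (by positivity)
    calc μ {g | ‖ρ g - 1‖ ≤ 2 ^ (k + 1) * r}
        = μ {g | ‖ρ g - 1‖ ≤ 2 * (2 ^ k * r)} := by rw [pow_succ]; ring_nf
      _ ≤ 5 ^ Module.finrank ℝ (Matrix (Fin N) (Fin N) ℂ) * μ {g | ‖ρ g - 1‖ ≤ 2 ^ k * r} := h
      _ ≤ 5 ^ Module.finrank ℝ (Matrix (Fin N) (Fin N) ℂ) *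
          ((5 ^ Module.finrank ℝ (Matrix (Fin N) (Fin N) ℂ)) ^ k * μ {g | ‖ρ g - 1‖ ≤ r}) := by
        gcongr
      _ = (5 ^ Module.finrank ℝ (Matrix (Fin N) (Fin N) ℂ)) ^ (k + 1) * μ {g | ‖ρ g - 1‖ ≤ r} := by
        rw [pow_succ]; ring

end MatrixGroup

end Literature.MeasureTheory.Group
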